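import Summits.QuantumFields.YangMills.Theorems.FluctuationComparisonRegPrIntLS2BetaParityDescentExists
import HarnessLib

/-!
# S2β · D-GUARD ∕ (BG∞) — THE DESCENDED BLOCK ((L-Σ) bookkeeping, UV3-NODE §116 ADD.1∕ADD.2; binder style): a DESCENT FUNCTION `D : Fin M → ZMod N → Fin M` exists
# (skolemising ✓`exists_descent`); along each axis it keeps the residue inside, agrees from both sides, is even on an odd face and the identity off it, never raises
# parity; applied coordinatewise to a block `Q : Fin d → Fin M` at a site `x : Fin d → ZMod N` it gives the DESCENDED BLOCK `κ ↦ D (Q κ) (x κ)` — contains `x`, is the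
# same from any two closed blocks containing `x`, equals `Q` off the odd faces, and has STRICTLY fewer odd axes when `x` lies on an odd face of `Q`

Cell `ym3-torus` (YM ladder rung R3 = continuum `SU(2)` Yang–Mills on the three-torus at fixed lattice data — a RUNG: NOT d = 4, NOT infinite volume,
NOT a mass gap, NOT Clay).  Width seat «width 19» `ym3-torus-px19` (gen 25, ★p1 lineage), FREE px helper on crux `stmt-QuantumFields-20520`
(`FluctuationComparisonRegPrIntL`; registry `Lines/semiclassical_s2beta.lean` UNTOUCHED, 0∕5); `--kind proof --supports stmt-QuantumFields-20520 --as helper`,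
count-neutral, DEFINITION-FREE (0 `def`, 0 `instance`, 0 `notation`, 0 `sorry`, default heartbeats).  (BG∞) plan of record: UV3-NODE §116 + ADD.1 + ADD.2
(architect ruling px17 g23; desk RULINGs №123∕№127∕№132; LEAD RULING №66).

WHY (ADD.2 (CONS)∕(DESC)∕(STEP)).  The sections theorem `hSec` (the one hypothesis of ✓`hBG_of_sections`) is assembled from block-local fillings by the rule
«on an odd face of `Q` the section of `Q` continues the section of the DESCENDED block `D(Q,x)`».  Consistency on overlaps is then `D(Q,x) = D(Q′,x)`
(✓`descent_agrees`, coordinatewise) and the induction on the stage runs on `#odd axes`, which this file shows DROPS strictly along a descent from an odd face.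
Everything here is the coordinatewise lift of ✓p839801 ∕ ✓p840146; the descent is carried as a FUNCTION `D` with its defining relation `hD` displayed
(no definition is made: `∃ D, …` is ✓`exists_descent` + choice).

WHAT IS PROVED (sorry-free).
* §1 (one axis) `exists_descentFun` · `descentFun_mem` · `descentFun_agrees` · `descentFun_even_of_face` · `descentFun_eq_self` · `descentFun_parity_le` · `descentFun_odd_imp`.
* §2 (a block, any dimension `d`) `dblock_mem` · ★`dblock_agrees` (`funext` of §1) · `dblock_eq_self` · `dblock_odd_imp` · ★`dblock_filter_odd_ssubset` and
  ★`dblock_card_odd_lt` — on an odd face the descended block has strictly fewer odd axes.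

HONEST SCOPE.  `Fin`∕`ZMod`∕`Finset` bookkeeping; no gauge field, no group; nothing of Bałaban's renormalisation-group analysis is asserted or proved
([Balaban1985RegularSpaces] Lemma 1 p.79 is the local cube partition in print; the torus-global parity descent is the (BG∞) plan's device, NOT in print).
(BG∞) ∕ `hBG` ∕ `hSec` are NOT proved; GAP♯∘, the five registered stubs (0∕5), S2β, 20520, 19936, 19200, `YM3TorusSU2` are NOT proved; rung R3 — NOT d = 4, NOT
infinite volume, NOT a mass gap, NOT Clay; the Yang–Mills mass gap is NOT proved.  Axioms standard.

References: T. Bałaban, CMP **99** (1985) 75–102 [Balaban1985RegularSpaces] (Lemma 1 p.79).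
-/

set_option autoImplicit false

namespace Summit.QuantumFields.YangMills.Theorems.FluctuationComparisonRegPrIntLS2BetaDescendedBlock

open Summit.QuantumFields.YangMills.Theorems.FluctuationComparisonRegPrIntLS2BetaParityDescent (descent_agrees odd_iff_succ_even)
open Summit.QuantumFields.YangMills.Theorems.FluctuationComparisonRegPrIntLS2BetaParityDescentExists
  (exists_descent memClosed_of_descent descent_parity_le)

variable {M N : ℕ} [NeZero N] (len start : Fin M → ℕ)

/-! ## §1 One axis: a descent function and its laws -/

omit [NeZero N] in
/-- ★ **A DESCENT FUNCTION EXISTS**: a choice of descent `D i v` for every block `i` and residue `v` (✓`exists_descent` + choice). [folklore] -/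
theorem exists_descentFun :
    ∃ D : Fin M → ZMod N → Fin M, ∀ (i : Fin M) (v : ZMod N),
      ((i : ℕ) % 2 = 1 ∧ (v - ((start i : ℕ) : ZMod N)).val = 0 ∧ ((i : ℕ) = (D i v : ℕ) + 1 ∨ ((D i v : ℕ) + 1 = M ∧ (i : ℕ) = 0))) ∨
      ((i : ℕ) % 2 = 1 ∧ (v - ((start i : ℕ) : ZMod N)).val = len i ∧ ((D i v : ℕ) = (i : ℕ) + 1 ∨ ((i : ℕ) + 1 = M ∧ (D i v : ℕ) = 0))) ∨
      (¬ ((i : ℕ) % 2 = 1 ∧ ((v - ((start i : ℕ) : ZMod N)).val = 0 ∨ (v - ((start i : ℕ) : ZMod N)).val = len i)) ∧ D i v = i) :=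
  ⟨fun i v => Classical.choose (exists_descent len start i v), fun i v => Classical.choose_spec (exists_descent len start i v)⟩

section OneAxis
variable (hlen : ∀ i, 1 ≤ len i)
  (hz : ∀ i : Fin M, (i : ℕ) = 0 → start i = 0)
  (hs : ∀ i j : Fin M, (j : ℕ) = (i : ℕ) + 1 → start j = start i + len i)
  (hl : ∀ i : Fin M, (i : ℕ) + 1 = M → start i + len i = N) (hM : 3 ≤ M) (hEven : Even M)
  (D : Fin M → ZMod N → Fin M)
  (hD : ∀ (i : Fin M) (v : ZMod N),
      ((i : ℕ) % 2 = 1 ∧ (v - ((start i : ℕ) : ZMod N)).val = 0 ∧ ((i : ℕ) = (D i v : ℕ) + 1 ∨ ((D i v : ℕ) + 1 = M ∧ (i : ℕ) = 0))) ∨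
      ((i : ℕ) % 2 = 1 ∧ (v - ((start i : ℕ) : ZMod N)).val = len i ∧ ((D i v : ℕ) = (i : ℕ) + 1 ∨ ((i : ℕ) + 1 = M ∧ (D i v : ℕ) = 0))) ∨
      (¬ ((i : ℕ) % 2 = 1 ∧ ((v - ((start i : ℕ) : ZMod N)).val = 0 ∨ (v - ((start i : ℕ) : ZMod N)).val = len i)) ∧ D i v = i))

include hlen hz hs hl hD in
/-- The descended block contains the residue. [folklore] -/
theorem descentFun_mem (i : Fin M) (v : ZMod N) (hi : (v - ((start i : ℕ) : ZMod N)).val ≤ len i) :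
    (v - ((start (D i v) : ℕ) : ZMod N)).val ≤ len (D i v) :=
  memClosed_of_descent len start hlen hz hs hl i (D i v) v hi (hD i v)

include hlen hz hs hl hM hEven hD in
/-- ★ The descent is the same from any two closed blocks containing the residue (✓`descent_agrees`). [folklore] -/
theorem descentFun_agrees (i i' : Fin M) (v : ZMod N) (hi : (v - ((start i : ℕ) : ZMod N)).val ≤ len i)
    (hi' : (v - ((start i' : ℕ) : ZMod N)).val ≤ len i') : D i v = D i' v :=
  descent_agrees len start hlen hz hs hl hM hEven i i' (D i v) (D i' v) v hi hi' (hD i v) (hD i' v)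

omit [NeZero N] in
include hEven hD in
/-- ★ On a face of an ODD block the descended block is EVEN (parity alternates around the even cycle). [folklore] -/
theorem descentFun_even_of_face (i : Fin M) (v : ZMod N) (ho : (i : ℕ) % 2 = 1)
    (hf : (v - ((start i : ℕ) : ZMod N)).val = 0 ∨ (v - ((start i : ℕ) : ZMod N)).val = len i) : ((D i v : ℕ)) % 2 = 0 := by
  rcases hD i v with ⟨-, -, hp⟩ | ⟨-, -, hsu⟩ | ⟨hno, -⟩
  · -- `i` is the successor of `D i v`
    have h := odd_iff_succ_even hEven (D i v) i hp
    omega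
  · exact (odd_iff_succ_even hEven i (D i v) hsu).1 ho
  · exact (hno ⟨ho, hf⟩).elim

omit [NeZero N] in
include hD in
/-- Off the odd faces the descent is the identity. [folklore] -/
theorem descentFun_eq_self (i : Fin M) (v : ZMod N)
    (h : ¬ ((i : ℕ) % 2 = 1 ∧ ((v - ((start i : ℕ) : ZMod N)).val = 0 ∨ (v - ((start i : ℕ) : ZMod N)).val = len i))) : D i v = i := by
  rcases hD i v with ⟨ho, h0, -⟩ | ⟨ho, hL, -⟩ | ⟨-, he⟩
  · exact (h ⟨ho, Or.inl h0⟩).elim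
  · exact (h ⟨ho, Or.inr hL⟩).elim
  · exact he

omit [NeZero N] in
include hEven hD in
/-- Parity never goes up along a descent. [folklore] -/
theorem descentFun_parity_le (i : Fin M) (v : ZMod N) : ((D i v : ℕ)) % 2 ≤ (i : ℕ) % 2 :=
  descent_parity_le len start hEven i (D i v) v (hD i v)

omit [NeZero N] in
include hEven hD in
/-- If the descended block is odd then so was the block. [folklore] -/
theorem descentFun_odd_imp (i : Fin M) (v : ZMod N) (h : ((D i v : ℕ)) % 2 = 1) : (i : ℕ) % 2 = 1 := by
  have := descentFun_parity_le len start hEven D hD i v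
  omega

end OneAxis

/-! ## §2 A block of any dimension: the descended block, coordinatewise -/

section Block
variable {d : ℕ} (hlen : ∀ i, 1 ≤ len i)
  (hz : ∀ i : Fin M, (i : ℕ) = 0 → start i = 0)
  (hs : ∀ i j : Fin M, (j : ℕ) = (i : ℕ) + 1 → start j = start i + len i)
  (hl : ∀ i : Fin M, (i : ℕ) + 1 = M → start i + len i = N) (hM : 3 ≤ M) (hEven : Even M)
  (D : Fin M → ZMod N → Fin M)
  (hD : ∀ (i : Fin M) (v : ZMod N),
      ((i : ℕ) % 2 = 1 ∧ (v - ((start i : ℕ) : ZMod N)).val = 0 ∧ ((i : ℕ) = (D i v : ℕ) + 1 ∨ ((D i v : ℕ) + 1 = M ∧ (i : ℕ) = 0))) ∨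
      ((i : ℕ) % 2 = 1 ∧ (v - ((start i : ℕ) : ZMod N)).val = len i ∧ ((D i v : ℕ) = (i : ℕ) + 1 ∨ ((i : ℕ) + 1 = M ∧ (D i v : ℕ) = 0))) ∨
      (¬ ((i : ℕ) % 2 = 1 ∧ ((v - ((start i : ℕ) : ZMod N)).val = 0 ∨ (v - ((start i : ℕ) : ZMod N)).val = len i)) ∧ D i v = i))

include hlen hz hs hl hD in
/-- The descended block contains the site. [folklore] -/
theorem dblock_mem (Q : Fin d → Fin M) (x : Fin d → ZMod N) (hx : ∀ κ, (x κ - ((start (Q κ) : ℕ) : ZMod N)).val ≤ len (Q κ)) :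
    ∀ κ, (x κ - ((start (D (Q κ) (x κ)) : ℕ) : ZMod N)).val ≤ len (D (Q κ) (x κ)) :=
  fun κ => descentFun_mem len start hlen hz hs hl D hD (Q κ) (x κ) (hx κ)

include hlen hz hs hl hM hEven hD in
/-- ★★ **THE DESCENDED BLOCK IS THE SAME FROM ANY TWO CLOSED BLOCKS CONTAINING THE SITE** — the consistency engine of (L-Σ). [folklore] -/
theorem dblock_agrees (Q Q' : Fin d → Fin M) (x : Fin d → ZMod N) (hx : ∀ κ, (x κ - ((start (Q κ) : ℕ) : ZMod N)).val ≤ len (Q κ))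
    (hx' : ∀ κ, (x κ - ((start (Q' κ) : ℕ) : ZMod N)).val ≤ len (Q' κ)) :
    (fun κ => D (Q κ) (x κ)) = fun κ => D (Q' κ) (x κ) :=
  funext fun κ => descentFun_agrees len start hlen hz hs hl hM hEven D hD (Q κ) (Q' κ) (x κ) (hx κ) (hx' κ)

omit [NeZero N] in
include hD in
/-- Off all odd faces the descended block is the block itself. [folklore] -/
theorem dblock_eq_self (Q : Fin d → Fin M) (x : Fin d → ZMod N)
    (h : ∀ κ, ¬ (((Q κ : Fin M) : ℕ) % 2 = 1 ∧ ((x κ - ((start (Q κ) : ℕ) : ZMod N)).val = 0 ∨ (x κ - ((start (Q κ) : ℕ) : ZMod N)).val = len (Q κ)))) :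
    (fun κ => D (Q κ) (x κ)) = Q :=
  funext fun κ => descentFun_eq_self len start D hD (Q κ) (x κ) (h κ)

omit [NeZero N] in
include hEven hD in
/-- An odd axis of the descended block is an odd axis of the block. [folklore] -/
theorem dblock_odd_imp (Q : Fin d → Fin M) (x : Fin d → ZMod N) (κ : Fin d) (h : ((D (Q κ) (x κ) : Fin M) : ℕ) % 2 = 1) :
    ((Q κ : Fin M) : ℕ) % 2 = 1 :=
  descentFun_odd_imp len start hEven D hD (Q κ) (x κ) h

omit [NeZero N] in
include hEven hD in
/-- ★ **ON AN ODD FACE THE ODD AXES OF THE DESCENDED BLOCK ARE A STRICT SUBSET** of the block's. [folklore] -/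
theorem dblock_filter_odd_ssubset (Q : Fin d → Fin M) (x : Fin d → ZMod N) (κ₀ : Fin d) (ho : ((Q κ₀ : Fin M) : ℕ) % 2 = 1)
    (hf : (x κ₀ - ((start (Q κ₀) : ℕ) : ZMod N)).val = 0 ∨ (x κ₀ - ((start (Q κ₀) : ℕ) : ZMod N)).val = len (Q κ₀)) :
    (Finset.univ.filter fun κ => ((D (Q κ) (x κ) : Fin M) : ℕ) % 2 = 1) ⊂ Finset.univ.filter fun κ => ((Q κ : Fin M) : ℕ) % 2 = 1 := by
  rw [Finset.ssubset_iff_subset_ne]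
  refine ⟨fun κ hκ => ?_, fun heq => ?_⟩
  · rw [Finset.mem_filter] at hκ ⊢
    exact ⟨hκ.1, dblock_odd_imp len start hEven D hD Q x κ hκ.2⟩
  · have hmem : κ₀ ∈ Finset.univ.filter fun κ => ((Q κ : Fin M) : ℕ) % 2 = 1 := by
      rw [Finset.mem_filter]; exact ⟨Finset.mem_univ _, ho⟩
    rw [← heq, Finset.mem_filter] at hmem
    have heven := descentFun_even_of_face len start hEven D hD (Q κ₀) (x κ₀) ho hf
    omega

omit [NeZero N] in
include hEven hD in
/-- ★★ **THE STAGE DROPS ALONG A DESCENT FROM AN ODD FACE**: `#odd axes of D(Q,x) < #odd axes of Q` when `x` lies on an odd face of `Q`. [folklore] -/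
theorem dblock_card_odd_lt (Q : Fin d → Fin M) (x : Fin d → ZMod N) (κ₀ : Fin d) (ho : ((Q κ₀ : Fin M) : ℕ) % 2 = 1)
    (hf : (x κ₀ - ((start (Q κ₀) : ℕ) : ZMod N)).val = 0 ∨ (x κ₀ - ((start (Q κ₀) : ℕ) : ZMod N)).val = len (Q κ₀)) :
    (Finset.univ.filter fun κ => ((D (Q κ) (x κ) : Fin M) : ℕ) % 2 = 1).card < (Finset.univ.filter fun κ => ((Q κ : Fin M) : ℕ) % 2 = 1).card :=
  Finset.card_lt_card (dblock_filter_odd_ssubset len start hEven D hD Q x κ₀ ho hf)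

omit [NeZero N] in
include hEven hD in
/-- The stage never goes up along a descent. [folklore] -/
theorem dblock_card_odd_le (Q : Fin d → Fin M) (x : Fin d → ZMod N) :
    (Finset.univ.filter fun κ => ((D (Q κ) (x κ) : Fin M) : ℕ) % 2 = 1).card ≤ (Finset.univ.filter fun κ => ((Q κ : Fin M) : ℕ) % 2 = 1).card := by
  apply Finset.card_le_card
  intro κ hκ
  rw [Finset.mem_filter] at hκ ⊢
  exact ⟨hκ.1, dblock_odd_imp len start hEven D hD Q x κ hκ.2⟩

end Block

end Summit.QuantumFields.YangMills.Theorems.FluctuationComparisonRegPrIntLS2BetaDescendedBlock
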